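import Literature.AnabelianGeometry.EtaleTheta.TowerOfSetting
import Mathlib.Tactic.LinearCombination
import HarnessLib

/-!
# [EtTh] §5, Thm. 5.7 (C)-chain: the REPAIRED cross-level separation binder `hsep^{(2l)}` FOLLOWS from an exact orbit display
# `σ·η̈ = η̈ − 2a·log(Ü) − a²·log(q̈)` (Prop. 1.5 (iii) with trivial unit), the generator clause for `log(Ü)` on `Δ^tp_Ÿ̲̲`
# (Prop. 1.5 (ii)) and the centrality of `Δ_Θ` — levelwise, for every pair of members

S. Mochizuki, *The étale theta function and its Frobenioid-theoretic manifestations*, Publ. RIMS **45** (2009) [EtTh]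
(refereed): Prop. 1.5 (ii)/(iii) p. 249 (PDF p. 23: "`F̈¹/F̈² = Ẑ·log(Ü)`"; "`η̈^Θ ↦ η̈^Θ − 2a·log(Ü) − (a²/2)·log(q_X) +
log(O^×_K̈)`"), Cor. 2.8 (i) p. 268 (PDF p. 42), Def. 2.13 pp. 272–273 (PDF pp. 46–47), §1 p. 238 (PDF p. 12)
[cite: MochizukiEtTh2009, Prop 1.5 (iii) p.249 (PDF p.23); Def 2.13 p.272 (PDF p.46)].
Layer L2 of the abc-iut cell, seat abc-iut-f-123 (gen 8), abc-iut-L2-lead row R983/R1139 «HSEP@TATE-DATUM» (repaired form).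

PROOF-ONLY (0 definitions, 0 `Prop` facts) over abc-iut-L2-t8's `ThetaEnvOfSetting` / `TowerOfSetting`.  CONTEXT: this seat's
p497402 / p498173 refute the exponent-`2` separation binder `hsep` of the Thm. 5.7 closers at the Tate datum for `l ∣ p − 1`, and
p498016 shows the (C)-chain only needs the exponent-`2l` form `hsep^{(2l)}`.  THIS FILE proves `hsep^{(2l)}` — in fact for EVERY
pair of members `η, η'` of the mod-`N` collection whose ratio is `aug`-inflated (no compatibility across levels needed) — from
three print-shaped inputs on the §1/§2 objects, stated as hypotheses to be discharged at data (sequel: the model of record):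

* `hdisp` — EXACT ORBIT DISPLAY (Prop. 1.5 (iii) with unit `1`): for `σ ∈ Π^tp_X̲̲`, `σ·η̈ = η̈ · L_c^{−2a(σ)} · Q_c^{−a(σ)²}` in
  `H¹(Π^tp_Ÿ, Δ_Θ)` with `l ∣ a(σ)` (`toZ(Π^tp_X̲̲) = l·ℤ`, Def. 2.5 (i)), for two classes `L_c` ("`log(Ü)`") and `Q_c` ("`log(q̈)`")
  given with continuous cocycle representatives `lf`, `qf` on `Π^tp_Ÿ̲̲` (`hlfc`, `hqfc`);
* the GENERATOR CLAUSE (Prop. 1.5 (ii) "`F̈¹/F̈² = Ẑ·log(Ü)`", levelwise): at one element `k₀ ∈ Δ^tp_Ÿ̲̲` (`aug k₀ = 1`) the value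
  `lf(k₀)^l ∈ l·Δ_Θ` reduces to a GENERATOR of `μ_N` (`hgen`), while `qf(k₀) = 1` (`hqk₀`: a Kummer class of a constant dies on
  `Δ^tp`);
* CENTRALITY at `k₀`: conjugation by `k₀` is trivial on `Δ_Θ` (`hΔ`; §1 p. 12: `Δ_Θ` central in `Δ^Θ_X`).

ARGUMENT (`ratio_pow_two_mul_eq_coboundary_of_orbitDisplay`).  Members are reductions of root cocycles `f, f'` with classes
`res(σ·η̈)`, `res(σ'·η̈)`; by `hdisp` the quotient `f'·f⁻¹` is, up to a coboundary `∂e`, the cocycle `lf^{m₁}·qf^{m₂}` with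
`m₁ = −2(a' − a)`, `m₂ = −(a'² − a²)` (`exists_conj_mul_of_mk_eq`); evaluating at `k₀` (where `qf`, `∂e` die and the
`aug`-inflated ratio equals its value at `1`, namely `1`) gives `red_N(lf(k₀)^l)^{−2(a'−a)/l} = 1`, so `N ∣ 2(a' − a)/l`; then the
`(2l)`-th power of the ratio is `red_N` of an `N`-th power times `∂(e^{2l})`, and `e^{2l} = (e²)^l ∈ l·Δ_Θ`, so it is the
`μ_N`-coboundary of `red_N(e^{2l})⁻¹` (`red_pow_two_mul_of_decomp`) — exactly where exponent `2` fails (p497402: `e` itself need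
not lie in `l·Δ_Θ`).  Tower form: `hsepPow_of_orbitDisplay`.

HONEST FRAMING: kernel-checked implications between TYPED statements; the three inputs are hypotheses here (print's Prop. 1.5
(ii)/(iii) content in exact form), discharged at no datum in this file; nothing of [EtTh] is asserted; typed ≠ proved; no side
is taken on [IUTchIII] Cor. 3.12.
-/

noncomputable section

namespace Literature.AnabelianGeometry.EtaleTheta

open Literature.AnabelianGeometry.SemiGraphs
open scoped IsMulCommutative

/-! ### Group-theoretic bookkeeping -/

/-- If `x = R·L^u·Q^v` and `x' = R·L^{u'}·Q^{v'}` in a commutative group then `x' = x·(L^{u'−u}·Q^{v'−v})` (the quotient of two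
orbit classes, Prop. 1.5 (iii)). [cite: MochizukiEtTh2009, Prop 1.5 (iii) p.249 (PDF p.23)] -/
theorem eq_mul_zpow_sub_mul_zpow_sub {G : Type*} [CommGroup G] {x x' R L Q : G} {u v u' v' : ℤ}
    (hx : x = R * L ^ u * Q ^ v) (hx' : x' = R * L ^ u' * Q ^ v') :
    x' = x * (L ^ (u' - u) * Q ^ (v' - v)) := by
  obtain ⟨d₁, rfl⟩ : ∃ d, u' = u + d := ⟨u' - u, by ring⟩
  obtain ⟨d₂, rfl⟩ : ∃ d, v' = v + d := ⟨v' - v, by ring⟩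
  rw [hx, hx', add_sub_cancel_left, add_sub_cancel_left, zpow_add, zpow_add]
  simp only [mul_assoc, mul_left_comm]

/-- Exponent bookkeeping in a commutative group with an endomorphism `φ`: if `m₁·2l = l·N·z₁` and `m₂·2l = l·N·z₂` then
`(L^{m₁}·Q^{m₂}·(φ e·e⁻¹))^{2l} = (L^l)^{N z₁}·(Q^l)^{N z₂}·(φ((e²)^l)·((e²)^l)⁻¹)` ("modifying a cocycle by a coboundary",
Def. 2.13 p. 47, after raising to the `(2l)`-th power). [cite: MochizukiEtTh2009, Def 2.13 p.273 (PDF p.47)] -/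
theorem mul_zpow_mul_conj_pow_two_mul {G F : Type*} [CommGroup G] [FunLike F G G] [MonoidHomClass F G G] (φ : F)
    (L Q e : G) {m₁ m₂ z₁ z₂ : ℤ} {l N : ℕ}
    (hz₁ : m₁ * ((2 * l : ℕ) : ℤ) = (l : ℤ) * ((N : ℤ) * z₁)) (hz₂ : m₂ * ((2 * l : ℕ) : ℤ) = (l : ℤ) * ((N : ℤ) * z₂)) :
    (L ^ m₁ * Q ^ m₂ * (φ e * e⁻¹)) ^ (2 * l) =
      (L ^ l) ^ ((N : ℤ) * z₁) * (Q ^ l) ^ ((N : ℤ) * z₂) * (φ ((e ^ 2) ^ l) * ((e ^ 2) ^ l)⁻¹) := by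
  have hL : (L ^ m₁) ^ (2 * l) = (L ^ l) ^ ((N : ℤ) * z₁) := by
    rw [← zpow_natCast (L ^ m₁) (2 * l), ← zpow_mul, hz₁, zpow_mul L (l : ℤ), zpow_natCast L l]
  have hQ : (Q ^ m₂) ^ (2 * l) = (Q ^ l) ^ ((N : ℤ) * z₂) := by
    rw [← zpow_natCast (Q ^ m₂) (2 * l), ← zpow_mul, hz₂, zpow_mul Q (l : ℤ), zpow_natCast Q l]
  rw [mul_pow, mul_pow, mul_pow, hL, hQ, ← map_pow, inv_pow, pow_mul]

/-- In a finite cyclic group of order `n` with generator `g`: `g^z = 1 ⇒ n ∣ z`. [cite: MochizukiEtTh2009, Def 2.10 p.270 (PDF p.44)] -/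
theorem natCast_dvd_of_zpow_eq_one {G : Type*} [Group G] [Fintype G] {g : G} (hg : ∀ x, x ∈ Subgroup.zpowers g)
    {n : ℕ} (hn : Fintype.card G = n) {z : ℤ} (hz : g ^ z = 1) : (n : ℤ) ∣ z := by
  rw [← hn, ← Nat.card_eq_fintype_card, ← orderOf_eq_card_of_forall_mem_zpowers hg, orderOf_dvd_iff_zpow_eq_one]
  exact hz

namespace ThetaSetting

namespace EtaleThetaData.DoubleUnderline

variable {p : ℕ} [Fact p.Prime] {D : ThetaSetting p} {E : D.EtaleThetaData} {l : ℕ}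
  (C : E.DoubleUnderline l) {Es : Set ℕ+} (τ : D.CyclotomeTower l Es) (hC : D.Compat) (hS : D.Sec2Hyps)

/-! ### Bookkeeping: cocycles at `1`, reductions at `1`, ratios of reductions, equal classes -/

/-- A continuous cocycle takes the value `1` at `1` (`f(1) = f(1)·f(1)`). [cite: MochizukiEtTh2009, Def 2.13 p.272 (PDF p.46)] -/
theorem contCocycle_apply_one (H : Subgroup D.PiTemp) (f : contCocycles D.toTheta D.DeltaTheta H) : f.1 1 = 1 := by
  have h := f.2.2 1 1
  rw [mul_one, OneMemClass.coe_one, map_one, map_one, MulAut.one_apply] at h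
  exact (left_eq_mul.mp h)

/-- The mod-`N` reduction of a root cocycle is `1` at `1`. [cite: MochizukiEtTh2009, Def 2.13 p.272 (PDF p.46)] -/
theorem modN_apply_one {N : ℕ+} (μ : D.CyclotomeMod l N) (f : contCocycles D.toTheta D.DeltaTheta C.GtpYdduu)
    (hf : ∀ g, (f.1 g : D.GtpTheta) ∈ D.lDeltaTheta l) : C.modN μ f hf 1 = 1 := by
  change μ.red ⟨(f.1 (C.inclYdduu 1) : D.GtpTheta), hf _⟩ = 1
  have h1 : (⟨(f.1 (C.inclYdduu 1) : D.GtpTheta), hf _⟩ : D.lDeltaTheta l) = 1 := Subtype.ext (by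
    show ((f.1 (C.inclYdduu 1) : D.DeltaTheta) : D.GtpTheta) = ((1 : D.lDeltaTheta l) : D.GtpTheta)
    rw [map_one, contCocycle_apply_one]
    rfl)
  rw [h1, map_one]

/-- The ratio of two reductions is the reduction of the quotient cocycle (`(l·Δ_Θ) ↠ μ_N` is a homomorphism).
[cite: MochizukiEtTh2009, Def 2.13 p.272 (PDF p.46)] -/
theorem modN_mul_modN_inv {N : ℕ+} (μ : D.CyclotomeMod l N) (f f' : contCocycles D.toTheta D.DeltaTheta C.GtpYdduu)
    (hf : ∀ g, (f.1 g : D.GtpTheta) ∈ D.lDeltaTheta l) (hf' : ∀ g, (f'.1 g : D.GtpTheta) ∈ D.lDeltaTheta l)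
    (k : D.GtpYdd.subgroupOf C.Huu) :
    C.modN μ f' hf' k * (C.modN μ f hf k)⁻¹ =
      μ.red ⟨((f'.1 (C.inclYdduu k) * (f.1 (C.inclYdduu k))⁻¹ : D.DeltaTheta) : D.GtpTheta),
        mul_mem (hf' _) (inv_mem (hf _))⟩ := by
  change μ.red _ * (μ.red _)⁻¹ = _
  rw [← map_inv, ← map_mul]
  rfl

/-- **Equal classes differ by a principal crossed homomorphism**, pointwise: if `[F] = [G]` in `H¹(H, Δ_Θ)` then
`F = G · ∂e` for some `e ∈ Δ_Θ` ("modifying a cocycle by a coboundary", Def. 2.13 p. 47). [cite: MochizukiEtTh2009, Def 2.13 p.273 (PDF p.47)] -/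
theorem exists_conj_mul_of_mk_eq {H : Subgroup D.PiTemp} (F G : contCocycles D.toTheta D.DeltaTheta H)
    (h : (QuotientGroup.mk F : D.H1 H) = QuotientGroup.mk G) :
    ∃ e : D.DeltaTheta, ∀ x : H, F.1 x = G.1 x * (MulAut.conjNormal (D.toTheta (x : D.PiTemp)) e * e⁻¹) := by
  rw [QuotientGroup.eq, Subgroup.mem_subgroupOf] at h
  obtain ⟨e, he⟩ := (mem_contCoboundaries_iff _).1 h
  refine ⟨e⁻¹, fun x => ?_⟩
  have hh := congrFun he x
  simp only [Subgroup.coe_mul, Subgroup.coe_inv, Pi.mul_apply, Pi.inv_apply] at hh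
  have hh' := inv_mul_eq_iff_eq_mul.1 hh
  rw [hh', map_inv, inv_inv, mul_assoc (F.1 x), mul_mul_mul_comm, mul_inv_cancel, inv_mul_cancel, mul_one, mul_one]

/-- Transport of an `l·Δ_Θ`-identity to `μ_N`, generator step: if `Φ₀ = (y^l)^z` in `Δ_Θ` and `red_N(Φ₀) = 1`, then
`red_N(y^l)^z = 1`. [cite: MochizukiEtTh2009, Def 2.13 p.272 (PDF p.46)] -/
theorem red_zpow_eq_one_of_eq {N : ℕ+} (μ : D.CyclotomeMod l N) (Φ₀ y : D.DeltaTheta) (z : ℤ)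
    (hΦ₀ : (Φ₀ : D.GtpTheta) ∈ D.lDeltaTheta l) (hid : Φ₀ = (y ^ l) ^ z) (hred : μ.red ⟨_, hΦ₀⟩ = 1) :
    μ.red ⟨((y ^ l : D.DeltaTheta) : D.GtpTheta), ⟨y, y.2, rfl⟩⟩ ^ z = 1 := by
  subst hid
  rw [← map_zpow, ← hred]
  congr 1

/-- Transport of an `l·Δ_Θ`-identity to `μ_N`, torsion step: if `Φ^{2l} = (L^l)^{N z₁}·(Q^l)^{N z₂}·((g·W·g⁻¹)·W⁻¹)` in `Δ_Θ`
with `W = (e²)^l`, then `red_N(Φ)^{2l}` is the `μ_N`-coboundary of `red_N(W)⁻¹` (the `N`-th powers die in `μ_N`; the conjugate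
reduces through the Galois action, Def. 2.13 p. 46). [cite: MochizukiEtTh2009, Def 2.13 p.272 (PDF p.46)] -/
theorem red_pow_two_mul_of_decomp {N : ℕ+} (μ : D.CyclotomeMod l N) (g : D.PiTemp) (Φ L Q e : D.DeltaTheta)
    (hΦ : (Φ : D.GtpTheta) ∈ D.lDeltaTheta l) {z₁ z₂ : ℤ}
    (hid : Φ ^ (2 * l) = (L ^ l) ^ (((N : ℕ) : ℤ) * z₁) * (Q ^ l) ^ (((N : ℕ) : ℤ) * z₂) *
      (MulAut.conjNormal (D.toTheta g) ((e ^ 2) ^ l) * ((e ^ 2) ^ l)⁻¹)) :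
    μ.red ⟨_, hΦ⟩ ^ (2 * l) =
      (μ.red ⟨(((e ^ 2) ^ l : D.DeltaTheta) : D.GtpTheta), ⟨e ^ 2, (e ^ 2).2, rfl⟩⟩)⁻¹ *
        (galMuN p N (D.aug.toMonoidHom g)
          (μ.red ⟨(((e ^ 2) ^ l : D.DeltaTheta) : D.GtpTheta), ⟨e ^ 2, (e ^ 2).2, rfl⟩⟩)⁻¹)⁻¹ := by
  have hN : ∀ x : MuN p N, x ^ (N : ℕ) = 1 := fun x => by
    have h := pow_card_eq_one (G := MuN p N) (x := x)
    rwa [card_MuN] at h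
  set W : D.lDeltaTheta l := ⟨(((e ^ 2) ^ l : D.DeltaTheta) : D.GtpTheta), ⟨e ^ 2, (e ^ 2).2, rfl⟩⟩ with hW
  -- the factors, as elements of `l·Δ_Θ`
  have hsub : (⟨_, hΦ⟩ : D.lDeltaTheta l) ^ (2 * l) =
      (⟨((L ^ l : D.DeltaTheta) : D.GtpTheta), ⟨L, L.2, rfl⟩⟩ : D.lDeltaTheta l) ^ (((N : ℕ) : ℤ) * z₁) *
        (⟨((Q ^ l : D.DeltaTheta) : D.GtpTheta), ⟨Q, Q.2, rfl⟩⟩ : D.lDeltaTheta l) ^ (((N : ℕ) : ℤ) * z₂) *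
        ((⟨D.toTheta g * (W : D.GtpTheta) * (D.toTheta g)⁻¹, (D.lDeltaTheta_normal l).conj_mem _ W.2 _⟩ :
            D.lDeltaTheta l) * W⁻¹) := by
    apply Subtype.ext
    show ((Φ ^ (2 * l) : D.DeltaTheta) : D.GtpTheta) = _
    rw [hid]
    simp only [hW, Subgroup.coe_mul, InvMemClass.coe_inv, SubgroupClass.coe_zpow, SubmonoidClass.coe_pow,
      MulAut.conjNormal_apply]
  rw [← map_pow, hsub, map_mul, map_mul, map_mul, map_zpow, map_zpow, map_inv, μ.red_conj, zpow_mul, zpow_mul,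
    zpow_natCast, zpow_natCast, hN, hN, one_zpow, one_zpow, one_mul, one_mul, map_inv, inv_inv, mul_comm]

/-! ### The levelwise theorem -/

/-- **`hsep^{(2l)}` levelwise from the exact orbit display, the generator clause and centrality.**  For a cyclotome
identification `μ` at level `N`, classes `L_c, Q_c ∈ H¹(Π^tp_Ÿ, Δ_Θ)` with cocycle representatives `lf, qf` on `Π^tp_Ÿ̲̲`, an
integer display function `a` on `Π^tp_X̲̲` divisible by `l`, and one element `k₀ ∈ Δ^tp_Ÿ̲̲` at which `red_N(lf(k₀)^l)` generates
`μ_N`, `qf(k₀) = 1` and conjugation is trivial on `Δ_Θ`: if `σ·η̈ = η̈·L_c^{−2a(σ)}·Q_c^{−a(σ)²}` for all `σ ∈ Π^tp_X̲̲`, then ANY two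
members `η, η'` of the mod-`N` collection of theta cocycles whose ratio is `aug`-inflated satisfy
`(η' k · (η k)⁻¹)^{2l} = d · (χ(aug k)·d)⁻¹` for one `d ∈ μ_N` and all `k`. [cite: MochizukiEtTh2009, Prop 1.5 (iii) p.249 (PDF p.23); Def 2.13 p.272 (PDF p.46)] -/
theorem ratio_pow_two_mul_eq_coboundary_of_orbitDisplay {N : ℕ+} (μ : D.CyclotomeMod l N)
    (Lc Qc : D.H1 D.GtpYdd) (a : D.PiTemp → ℤ) (ha : ∀ σ : D.PiTemp, σ ∈ C.Huu → (l : ℤ) ∣ a σ)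
    (hdisp : ∀ σ : D.PiTemp, σ ∈ C.Huu → haveI := hC.GtpYdd_normal
      ContH1.conj D.toTheta D.DeltaTheta σ E.etaDd = E.etaDd * Lc ^ (-(2 * a σ)) * Qc ^ (-(a σ ^ 2)))
    (lf : C.GtpYdduu → D.DeltaTheta) (hlf : lf ∈ contCocycles D.toTheta D.DeltaTheta C.GtpYdduu)
    (hlfc : ContH1.mk lf hlf = ContH1.res D.toTheta D.DeltaTheta inf_le_left Lc)
    (qf : C.GtpYdduu → D.DeltaTheta) (hqf : qf ∈ contCocycles D.toTheta D.DeltaTheta C.GtpYdduu)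
    (hqfc : ContH1.mk qf hqf = ContH1.res D.toTheta D.DeltaTheta inf_le_left Qc)
    (k₀ : D.GtpYdd.subgroupOf C.Huu) (hk₀ : D.aug ((k₀ : C.Huu) : D.PiTemp) = 1)
    (hgen : ∀ x : MuN p N, x ∈ Subgroup.zpowers
      (μ.red ⟨((lf (C.inclYdduu k₀) ^ l : D.DeltaTheta) : D.GtpTheta), ⟨lf (C.inclYdduu k₀), (lf _).2, rfl⟩⟩))
    (hqk₀ : qf (C.inclYdduu k₀) = 1)
    (hΔ : ∀ e : D.DeltaTheta, MulAut.conjNormal (D.toTheta ((k₀ : C.Huu) : D.PiTemp)) e = e)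
    {η η' : D.GtpYdd.subgroupOf C.Huu → MuN p N} (hη : η ∈ C.thetaCocycles hC μ) (hη' : η' ∈ C.thetaCocycles hC μ)
    (hinfl : ∀ k k' : D.GtpYdd.subgroupOf C.Huu,
      D.aug ((k : C.Huu) : D.PiTemp) = D.aug ((k' : C.Huu) : D.PiTemp) → η' k * (η k)⁻¹ = η' k' * (η k')⁻¹) :
    ∃ d : MuN p N, ∀ k : D.GtpYdd.subgroupOf C.Huu,
      (η' k * (η k)⁻¹) ^ (2 * l) = d * (galMuN p N (D.aug.toMonoidHom ((k : C.Huu) : D.PiTemp)) d)⁻¹ := by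
  classical
  haveI := hC.GtpYdd_normal
  obtain ⟨f, hf, rfl⟩ := hη
  obtain ⟨f', hf', rfl⟩ := hη'
  obtain ⟨σ, hσ, hfσ⟩ := hf.2
  obtain ⟨σ', hσ', hfσ'⟩ := hf'.2
  obtain ⟨α, hα⟩ := ha σ hσ
  obtain ⟨α', hα'⟩ := ha σ' hσ'
  -- Step 1: the orbit classes restricted to `Π^tp_Ÿ̲̲`, and the quotient class
  have hres : ∀ ρ : D.PiTemp, ρ ∈ C.Huu → ∀ {x : D.H1 C.GtpYdduu},
      x = ContH1.res D.toTheta D.DeltaTheta inf_le_left (ContH1.conj D.toTheta D.DeltaTheta ρ E.etaDd) →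
        x = ContH1.res D.toTheta D.DeltaTheta (inf_le_left : C.GtpYdduu ≤ D.GtpYdd) E.etaDd *
          ContH1.mk lf hlf ^ (-(2 * a ρ)) * ContH1.mk qf hqf ^ (-(a ρ ^ 2)) := by
    intro ρ hρ x hx
    rw [hx, hdisp ρ hρ, map_mul, map_mul, map_zpow, map_zpow, hlfc, hqfc]
  have hcl := eq_mul_zpow_sub_mul_zpow_sub (hres σ hσ hfσ) (hres σ' hσ' hfσ')
  obtain ⟨m₁, hm₁⟩ : ∃ m : ℤ, m = -(2 * a σ') - -(2 * a σ) := ⟨_, rfl⟩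
  obtain ⟨m₂, hm₂⟩ : ∃ m : ℤ, m = -(a σ' ^ 2) - -(a σ ^ 2) := ⟨_, rfl⟩
  rw [← hm₁, ← hm₂] at hcl
  -- Step 2: `f' · f⁻¹ = lf^{m₁} · qf^{m₂} · ∂e` pointwise
  have hq : (QuotientGroup.mk (f' * f⁻¹) : D.H1 C.GtpYdduu) =
      QuotientGroup.mk ((⟨lf, hlf⟩ : contCocycles D.toTheta D.DeltaTheta C.GtpYdduu) ^ m₁ *
        (⟨qf, hqf⟩ : contCocycles D.toTheta D.DeltaTheta C.GtpYdduu) ^ m₂) := by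
    change ContH1.mk f'.1 f'.2 * (ContH1.mk f.1 f.2)⁻¹ = ContH1.mk lf hlf ^ m₁ * ContH1.mk qf hqf ^ m₂
    rw [hcl, mul_inv_cancel_comm]
  obtain ⟨e, he⟩ := exists_conj_mul_of_mk_eq _ _ hq
  have hpt : ∀ h : C.GtpYdduu, f'.1 h * (f.1 h)⁻¹ =
      lf h ^ m₁ * qf h ^ m₂ * (MulAut.conjNormal (D.toTheta (h : D.PiTemp)) e * e⁻¹) := by
    intro h
    have hh := he h
    simpa only [Subgroup.coe_mul, Subgroup.coe_inv, SubgroupClass.coe_zpow, Pi.mul_apply, Pi.inv_apply,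
      Pi.pow_apply] using hh
  -- Step 3: evaluate at `k₀`: `N ∣ 2(α' − α)`
  have haug1 : D.aug ((k₀ : C.Huu) : D.PiTemp) = D.aug (((1 : D.GtpYdd.subgroupOf C.Huu) : C.Huu) : D.PiTemp) := by
    rw [hk₀, OneMemClass.coe_one, OneMemClass.coe_one, map_one]
  have hone := hinfl k₀ 1 haug1
  rw [C.modN_apply_one μ f hf.1, C.modN_apply_one μ f' hf'.1, inv_one, mul_one,
    C.modN_mul_modN_inv μ f f' hf.1 hf'.1 k₀] at hone
  have hΔ' : MulAut.conjNormal (D.toTheta ((C.inclYdduu k₀ : C.GtpYdduu) : D.PiTemp)) e = e := hΔ e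
  have hval₀ : f'.1 (C.inclYdduu k₀) * (f.1 (C.inclYdduu k₀))⁻¹ =
      (lf (C.inclYdduu k₀) ^ l) ^ (-(2 * (α' - α))) := by
    rw [hpt, hqk₀, hΔ', one_zpow, mul_one, mul_inv_cancel, mul_one, ← zpow_natCast, ← zpow_mul]
    congr 1
    rw [hm₁, hα, hα']
    ring
  have hgpow := red_zpow_eq_one_of_eq μ _ _ _ _ hval₀ hone
  obtain ⟨t, ht⟩ : ((N : ℕ) : ℤ) ∣ 2 * (α' - α) := by
    rw [← dvd_neg]
    exact natCast_dvd_of_zpow_eq_one hgen (card_MuN p N) hgpow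
  -- Step 4: the `(2l)`-th power of the ratio is the coboundary of `red((e²)^l)⁻¹`
  have hz₁ : m₁ * ((2 * l : ℕ) : ℤ) = (l : ℤ) * (((N : ℕ) : ℤ) * (-(2 * (l : ℤ) * t))) := by
    rw [hm₁, hα, hα']
    push_cast
    linear_combination (-(2 : ℤ) * (l : ℤ) ^ 2) * ht
  have hz₂ : m₂ * ((2 * l : ℕ) : ℤ) = (l : ℤ) * (((N : ℕ) : ℤ) * (-((l : ℤ) * t * (a σ' + a σ)))) := by
    have hdiff : a σ' - a σ = (l : ℤ) * (α' - α) := by rw [hα, hα']; ring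
    rw [hm₂]
    push_cast
    linear_combination (-((l : ℤ) ^ 2 * (a σ' + a σ))) * ht + (-((2 * l : ℤ) * (a σ' + a σ))) * hdiff
  refine ⟨(μ.red ⟨(((e ^ 2) ^ l : D.DeltaTheta) : D.GtpTheta), ⟨e ^ 2, (e ^ 2).2, rfl⟩⟩)⁻¹, fun k => ?_⟩
  rw [C.modN_mul_modN_inv μ f f' hf.1 hf'.1 k]
  exact red_pow_two_mul_of_decomp μ _ _ _ _ e _
    ((hpt (C.inclYdduu k)).symm ▸ mul_zpow_mul_conj_pow_two_mul _ _ _ e hz₁ hz₂)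

/-! ### The tower form: `hsep^{(2l)}` verbatim, for ALL pairs of families (no compatibility needed) -/

/-- **`hsep^{(2l)}` on the tower `C.thetaEnvTower τ hC hS` from the exact orbit display, the generator clause (at every level
of `Es`) and centrality**: for EVERY two families `η, η'` of members of the collections of mod-`M` theta cocycles whose ratio
is `aug`-inflated at every level — compatible or not — and every level `M`, the `(2l)`-th power of the ratio is a
`μ_M`-coboundary; i.e. the repaired separation binder of `ThetaEnvTower.etaleTorsion_of_cor219iiiStd_of_hsepPow` (p498016)
holds for every `η`. [cite: MochizukiEtTh2009, Prop 1.5 (iii) p.249 (PDF p.23); Def 2.13 p.272 (PDF p.46)] -/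
theorem hsepPow_of_orbitDisplay
    (Lc Qc : D.H1 D.GtpYdd) (a : D.PiTemp → ℤ) (ha : ∀ σ : D.PiTemp, σ ∈ C.Huu → (l : ℤ) ∣ a σ)
    (hdisp : ∀ σ : D.PiTemp, σ ∈ C.Huu → haveI := hC.GtpYdd_normal
      ContH1.conj D.toTheta D.DeltaTheta σ E.etaDd = E.etaDd * Lc ^ (-(2 * a σ)) * Qc ^ (-(a σ ^ 2)))
    (lf : C.GtpYdduu → D.DeltaTheta) (hlf : lf ∈ contCocycles D.toTheta D.DeltaTheta C.GtpYdduu)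
    (hlfc : ContH1.mk lf hlf = ContH1.res D.toTheta D.DeltaTheta inf_le_left Lc)
    (qf : C.GtpYdduu → D.DeltaTheta) (hqf : qf ∈ contCocycles D.toTheta D.DeltaTheta C.GtpYdduu)
    (hqfc : ContH1.mk qf hqf = ContH1.res D.toTheta D.DeltaTheta inf_le_left Qc)
    (k₀ : D.GtpYdd.subgroupOf C.Huu) (hk₀ : D.aug ((k₀ : C.Huu) : D.PiTemp) = 1)
    (hgen : ∀ (M : Es) (x : MuN p M), x ∈ Subgroup.zpowers
      ((τ.mod M).red ⟨((lf (C.inclYdduu k₀) ^ l : D.DeltaTheta) : D.GtpTheta), ⟨lf (C.inclYdduu k₀), (lf _).2, rfl⟩⟩))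
    (hqk₀ : qf (C.inclYdduu k₀) = 1)
    (hΔ : ∀ e : D.DeltaTheta, MulAut.conjNormal (D.toTheta ((k₀ : C.Huu) : D.PiTemp)) e = e)
    (η η' : ∀ M : Es, (C.thetaEnvTower τ hC hS).PiYdd → (C.thetaEnvTower τ hC hS).mu M)
    (hη : ∀ M, η M ∈ (C.thetaEnvTower τ hC hS).thetaCocycles M)
    (hη' : ∀ M, η' M ∈ (C.thetaEnvTower τ hC hS).thetaCocycles M)
    (hinfl : ∀ (M : Es) (k k' : (C.thetaEnvTower τ hC hS).PiYdd),
      (C.thetaEnvTower τ hC hS).aug k = (C.thetaEnvTower τ hC hS).aug k' → η' M k * (η M k)⁻¹ = η' M k' * (η M k')⁻¹)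
    (M : Es) :
    ∃ d : (C.thetaEnvTower τ hC hS).mu M, ∀ k : (C.thetaEnvTower τ hC hS).PiYdd,
      (η' M k * (η M k)⁻¹) ^ (2 * l) =
        CycEnvelope.coboundary ((C.thetaEnvTower τ hC hS).aug.comp (C.thetaEnvTower τ hC hS).PiYdd.subtype)
          ((C.thetaEnvTower τ hC hS).chi M) d k :=
  C.ratio_pow_two_mul_eq_coboundary_of_orbitDisplay hC (τ.mod M) Lc Qc a ha hdisp lf hlf hlfc qf hqf hqfc k₀ hk₀
    (hgen M) hqk₀ hΔ (hη M) (hη' M) fun k k' hkk => hinfl M k k' (Subtype.ext hkk)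

end EtaleThetaData.DoubleUnderline

end ThetaSetting

end Literature.AnabelianGeometry.EtaleTheta

end
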